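import Summits.QuantumFields.BalabanUV.Beta.D1BFx.NeedleGhostTadpoleRowSharp
import Summits.QuantumFields.BalabanUV.Beta.D1BFx.GhostLegBlockMass

/-!
# `BalabanUV.Beta.D1BFx.NeedleGhostTadpoleRowClosed` — road «BF-x» for binder row D1, slot (K), END row `hGrp gN`, (N-2) «NT-7» CLOSED FORM:
# **`h₇` OF `NeedleRowGlue.abs_gN_row_le_of_tables` WITH ONLY THE UNITS LINE DISPLAYED** — `NeedleGhostTadpoleRowSharp.h₇_sharp` (tolerance `n⁴`,
# M7-organised count) with its leg letter `hM0` DISCHARGED BY NAME by the tree's `GhostLegBlockMass.sum_B_abs_Ggh_le` (gan24-leaf-05-g41's courier of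
# an3-g57's corollary of `GhostLegFree.ghost_d0`, leaf-07-g3) at block distance `0` (`cM := cNear a`)

HONEST DEPENDENCY (cell records, verbatim): «continuum YM on T⁴ ⇐ BetaPertH ∧ nine spine estimates (0/9 proved); BetaPertH ⇐ (D1) ∧ (D4) ∧
CAP+tail; G-an2-4 gates asym, D1 and NE2/3/4.»  HONEST FRAMING (cell contract, verbatim): «discharging `BetaPertH` makes Bałaban's UV stability
UNCONDITIONAL — a real constructive-QFT result; it is NOT the continuum limit and NOT the Clay problem.»  THIS MODULE DISCHARGES NOTHING of the wall:
it is a [folklore] two-line composition BY NAME.  The scaling letter `|ωgh n·(x₀ n·cQ n)| ≤ k·n⁴` stays DISPLAYED — at the ray of record it reads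
`4N²a ≤ k` (owner FINDING U-1), ruled nowhere in this file; the weights are ARBITRARY sequences; nothing about Bałaban's operators is asserted.  No `def`,
no `def … : Prop`, nothing cited, 0 sorry.  Root-level binders hW ∕ hR-sockets ∕ hSX-socket ∕ D1Tel ∕ D1Rep — 0 discharged; (K) NOT closed; NOT D1,
NOT `BetaPertH`, NOT continuum, NOT Clay.

ABSOLUTE RULE (cell charter, verbatim): «No internally-minted statement may enter as a cited fact. Every hypothesis is either kernel-proved in this
package or a verbatim quotation of a PUBLISHED theorem with page reference. The manuscript(s) under audit are NOT citable for their own disputed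
steps — they are the thing under adjudication; programme-internal (2001/route/tribunal) claims are never citable.»

CONTENT (all [folklore]): `rowMass_Ggh_le_cNear` (`Σ_{z ∈ B(Y)} |Ggh n a x z| ≤ cNear a` — `sum_B_abs_Ggh_le` with `exp (−ghDelta·dist) ≤ 1`),
**`h₇_of_scaling (ha) (hk) (μ ν) ⊢ h₇`** with `C₇ := k·(cNear a + 2∕min 2 a)`.
Unit `b2b-balaban-beta-d1-formalise-leaf-04` (gen 8), D1 formalisation swarm; `LEAVES-BFx.md` row (N) ∕ «NT-7».
-/

noncomputable section

namespace Summit.QuantumFields.BalabanUV.Beta.D1BFx.NeedleGhostTadpoleRowClosed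

open Finset
open scoped BigOperators
open Literature.MathematicalPhysics.QuantumFieldTheory.Balaban1983to89
open Literature.MathematicalPhysics.QuantumFieldTheory.Balaban1983to89.Beta
open B6QGQLower276 (blk B)
open ExpKernelCalculus (Site)
open DyadicShell (Pt toReal)
open WindowIdentification (fullSum)
open DressedMomentNormalisation (resSite)
open Summit.QuantumFields.BalabanUV.Beta.D1BFx.DressedTablesLeg (tadpoleTableA)
open Summit.QuantumFields.BalabanUV.Beta.D1BFx.GhostLeg (Ggh)
open Summit.QuantumFields.BalabanUV.Beta.D1BFx.GhostStencilRootedReflection (ctrHalf)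
open Summit.QuantumFields.BalabanUV.Beta.D1BFx.GhostAveragingSquare (WghAt)
open Summit.QuantumFields.BalabanUV.Beta.D1BFx.GhostLegFree (ghDelta ghDelta_pos)
open Summit.QuantumFields.BalabanUV.Beta.D1BFx.GhostLegBlockMass (cNear ghA0_pos sum_B_abs_Ggh_le)
open Summit.QuantumFields.BalabanUV.Beta.D1BFx.NeedleGhostTadpoleRowSharp (h₇_sharp)

variable (n : ℕ) [NeZero n] {a : ℝ}

/-- [folklore] **THE GHOST LEG's BLOCK-ROW |·|-MASS AT ANY BLOCK IS `≤ cNear a`** (the distance-0 reading of `GhostLegBlockMass.sum_B_abs_Ggh_le`: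
drop the decay factor `exp (−ghDelta a·dist) ≤ 1`). -/
theorem rowMass_Ggh_le_cNear (ha : 0 < a) (x Y : Site 4) : ∑ z ∈ B (n - 1) Y, |Ggh n a x z () ()| ≤ cNear a := by
  have h := sum_B_abs_Ggh_le n ha x Y
  have hE : Real.exp (-(ghDelta a * dist (blk (n - 1) x) Y)) ≤ 1 := Real.exp_le_one_iff.mpr (by
    have h1 := ghDelta_pos ha
    have h2 : (0 : ℝ) ≤ dist (blk (n - 1) x) Y := dist_nonneg
    nlinarith)
  have hc : 0 ≤ cNear a := by
    unfold cNear
    have := ghA0_pos ha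
    have : 0 < min 2 a := lt_min two_pos ha
    positivity
  exact h.trans (mul_le_of_le_one_right hc hE)

variable {x₀ cK cQ ωgh : ℕ → ℝ} {k : ℝ}

/-- [folklore] **«NT-7» CLOSED: THE COMPLETED GHOST TADPOLE ROW `h₇` OF THE NEEDLE GROUP MODULO THE UNITS LINE ONLY** — displayed: `0 < a` and
`|ωgh n·(x₀ n·cQ n)| ≤ k·n⁴` for `n ≥ 2` (at the ray of record `= 4N²a·n⁴`: take `k := 4N²a`).  Output = `h₇` of `NeedleRowGlue.abs_gN_row_le_of_tables`
VERBATIM with `C₇ := k·(cNear a + 2∕min 2 a)` (`NeedleGhostTadpoleRowSharp.h₇_sharp` ∘ `GhostLegBlockMass.sum_B_abs_Ggh_le`). -/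
theorem h₇_of_scaling (ha : 0 < a) (hk : ∀ n : ℕ, 2 ≤ n → |ωgh n * (x₀ n * cQ n)| ≤ k * (n : ℝ) ^ 4) (μ ν : Fin 4) :
    ∀ n : ℕ, 2 ≤ n → ∀ [NeZero n], |ωgh n * ∑ b ∈ (univ : Finset (Fin 4 → Fin n)).image resSite, ((n : ℝ) ^ 4)⁻¹ * (((n : ℝ) ^ 8)⁻¹ *
      fullSum (fun w : Pt => toReal w μ * toReal w ν *
        tadpoleTableA (Ggh n a) (WghAt (ctrHalf n) n (x₀ n) (cK n) (cQ n)) μ ν (b + w) b))| ≤ k * (cNear a + 2 / min 2 a) :=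
  h₇_sharp ha (fun n _ _ x Y => rowMass_Ggh_le_cNear n ha x Y) hk μ ν

end Summit.QuantumFields.BalabanUV.Beta.D1BFx.NeedleGhostTadpoleRowClosed

end
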